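import Literature.Topology.FourManifolds.PlanarArch
import Literature.Topology.FourManifolds.RadialStretch
import HarnessLib

/-!
# Rounding a right-angle corner: a smooth embedded planar arc from a vertical ray to a horizontal ray

Topic `Literature/Topology/FourManifolds`; real-analysis toolkit in the spirit of
`PlanarArch.lean` / `ExplicitArch.lean` (planar arches between two parallel lines).  **Everything
here is proved; the definitions are explicit formulas.**

The union of the vertical ray `{0} × [0, ∞)` and the horizontal ray `(-∞, 0] × {0}` is a
piecewise smooth arc with a corner at the origin.  For box sizes `a, b > 0` we write down a
`C^∞` regular injective curve `CornerRounding.cornerArc a b : ℝ → ℝ²` that **coincides with the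
vertical ray above height `b`, with the horizontal ray left of abscissa `-a`, and rounds the
corner inside the open box `(-a, 0) × (0, b)`**:

* `CornerRounding.cornerRamp u = u · smoothTransition u` — smooth, `0` on `(-∞, 0]`, the identity on
  `[1, ∞)`, with values in `(0, 1)` on `(0, 1)`, monotone, strictly increasing on `[0, ∞)`
  (positive derivative on `(0, ∞)`);
* `CornerRounding.cornerArc a b u = (-a · cornerRamp (u + 1/2), b · cornerRamp (1/2 - u))`:
  `= (0, b (1/2 - u))` for `u ≤ -1/2` (the vertical ray, run downwards),
  `= (-a (u + 1/2), 0)` for `1/2 ≤ u` (the horizontal ray, run leftwards),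
  first coordinate in `(-a, 0)` and second in `(0, b)` for `|u| < 1/2`, always in the closed
  quadrant `{x ≤ 0 ≤ y}`; smooth (`contDiff_arc`), injective (`injective_arc`), with nowhere
  vanishing derivative (`deriv_arc_ne_zero`: at every `u` one of `u + 1/2`, `1/2 - u` is
  positive, and there the corresponding coordinate has nonzero derivative).

Use: smoothing the corners of a Jordan curve assembled from an arc transverse to a circle and
an arc of that circle, in tubular coordinates `(θ, s)` around the circle in which the transverse
arc is a fibre `{θ = θ₀}` — e.g. the curve `α ∪ β₁` made of a *wave* `α` of a cut system of a
handlebody and an arc `β₁` of the meridian it returns to (Hensel (2020), §5; the meridian-disc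
half of Griffiths' theorem, `HandlebodyKernelExtensionTorelli.lean`), or the boundary of a
region cut out by two transverse curve systems.  Translates, reflections and rescalings of
`cornerArc` give all four orientations of the corner.

## References

Standard real analysis; all statements are `[folklore]`.  Mathlib: `Real.smoothTransition`
(`Mathlib.Analysis.SpecialFunctions.SmoothTransition`); the tree's `pt2`, `hasDerivAt_pt2`
(`BandSum.lean`, `PlanarArch.lean`).
-/

open Set Function

noncomputable section

namespace Literature.Topology.FourManifolds

namespace CornerRounding

/-! ### The ramp `u ↦ u · smoothTransition u` -/

/-- **The ramp** `u ↦ u · smoothTransition u`: `0` for `u ≤ 0`, `u` for `u ≥ 1`. [folklore] -/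
def cornerRamp (u : ℝ) : ℝ := u * Real.smoothTransition u

/-- The ramp is smooth. [folklore] -/
theorem contDiff_ramp {n : ℕ∞} : ContDiff ℝ n cornerRamp :=
  contDiff_id.mul Real.smoothTransition.contDiff

/-- The ramp vanishes on `(-∞, 0]`. [folklore] -/
theorem ramp_of_nonpos {u : ℝ} (hu : u ≤ 0) : cornerRamp u = 0 := by
  rw [cornerRamp, Real.smoothTransition.zero_of_nonpos hu, mul_zero]

/-- The ramp is the identity on `[1, ∞)`. [folklore] -/
theorem ramp_of_one_le {u : ℝ} (hu : 1 ≤ u) : cornerRamp u = u := by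
  rw [cornerRamp, Real.smoothTransition.one_of_one_le hu, mul_one]

/-- The ramp is positive on `(0, ∞)`. [folklore] -/
theorem ramp_pos {u : ℝ} (hu : 0 < u) : 0 < cornerRamp u :=
  mul_pos hu (Real.smoothTransition.pos_of_pos hu)

/-- The ramp is nonnegative. [folklore] -/
theorem ramp_nonneg (u : ℝ) : 0 ≤ cornerRamp u := by
  rcases le_or_gt u 0 with hu | hu
  · rw [ramp_of_nonpos hu]
  · exact (ramp_pos hu).le

/-- The ramp is `< 1` on `(-∞, 1)`. [folklore] -/
theorem ramp_lt_one {u : ℝ} (hu : u < 1) : cornerRamp u < 1 := by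
  rcases le_or_gt u 0 with h0 | h0
  · rw [ramp_of_nonpos h0]; exact one_pos
  · calc cornerRamp u ≤ u * 1 := mul_le_mul_of_nonneg_left (Real.smoothTransition.le_one u) h0.le
      _ < 1 := by rw [mul_one]; exact hu

/-- The derivative of the ramp: `smoothTransition u + u · smoothTransition' u`. [folklore] -/
theorem hasDerivAt_ramp (u : ℝ) :
    HasDerivAt cornerRamp (Real.smoothTransition u + u * deriv Real.smoothTransition u) u := by
  have h := ((Real.smoothTransition.contDiff (n := 1)).differentiable (by simp) u).hasDerivAt
  have h2 := (hasDerivAt_id u).mul h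
  have he : (id * Real.smoothTransition : ℝ → ℝ) = cornerRamp := funext fun x => rfl
  rw [he] at h2
  simpa using h2

/-- The derivative of the ramp is positive on `(0, ∞)`. [folklore] -/
theorem deriv_ramp_pos {u : ℝ} (hu : 0 < u) : 0 < deriv cornerRamp u := by
  rw [(hasDerivAt_ramp u).deriv]
  exact add_pos_of_pos_of_nonneg (Real.smoothTransition.pos_of_pos hu)
    (mul_nonneg hu.le (deriv_smoothTransition_nonneg u))

/-- The derivative of the ramp vanishes on `(-∞, 0)` (the ramp is constant there). [folklore] -/
theorem deriv_ramp_of_neg {u : ℝ} (hu : u < 0) : deriv cornerRamp u = 0 := by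
  have hev : cornerRamp =ᶠ[nhds u] fun _ => (0 : ℝ) := by
    filter_upwards [Iio_mem_nhds hu] with x hx
    exact ramp_of_nonpos hx.le
  rw [hev.deriv_eq, deriv_const]

/-- The derivative of the ramp is nonnegative everywhere. [folklore] -/
theorem deriv_ramp_nonneg (u : ℝ) : 0 ≤ deriv cornerRamp u := by
  rw [(hasDerivAt_ramp u).deriv]
  rcases le_or_gt u 0 with hu | hu
  · rw [Real.smoothTransition.zero_of_nonpos hu, zero_add]
    -- `u ≤ 0` and `smoothTransition' u ≥ 0`: the product `u · st' u` is `≤ 0`... but it also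
    -- equals the derivative of the ramp, which vanishes for `u < 0`; at `u = 0` it is `0`.
    rcases hu.lt_or_eq with hlt | heq
    · have h := deriv_ramp_of_neg hlt
      rw [(hasDerivAt_ramp u).deriv, Real.smoothTransition.zero_of_nonpos hu, zero_add] at h
      rw [h]
    · rw [heq, zero_mul]
  · exact add_nonneg (Real.smoothTransition.nonneg u)
      (mul_nonneg hu.le (deriv_smoothTransition_nonneg u))

/-- The ramp is monotone. [folklore] -/
theorem monotone_ramp : Monotone cornerRamp :=
  monotone_of_deriv_nonneg ((contDiff_ramp (n := 1)).differentiable (by simp)) deriv_ramp_nonneg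

/-- The ramp is strictly increasing on `[0, ∞)`. [folklore] -/
theorem strictMonoOn_ramp : StrictMonoOn cornerRamp (Ici 0) := by
  refine strictMonoOn_of_deriv_pos (convex_Ici 0)
    (contDiff_ramp (n := 0)).continuous.continuousOn fun u hu => ?_
  rw [interior_Ici] at hu
  exact deriv_ramp_pos hu

/-! ### The corner arc -/

/-- **The corner arc** for the box `[-a, 0] × [0, b]`:
`u ↦ (-a · cornerRamp (u + 1/2), b · cornerRamp (1/2 - u))`. [folklore] -/
def cornerArc (a b : ℝ) (u : ℝ) : EuclideanSpace ℝ (Fin 2) :=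
  pt2 (-a * cornerRamp (u + 1 / 2)) (b * cornerRamp (1 / 2 - u))

variable {a b : ℝ}

/-- First coordinate of the corner arc. [folklore] -/
@[simp] theorem arc_apply_zero (a b u : ℝ) : cornerArc a b u 0 = -a * cornerRamp (u + 1 / 2) := rfl

/-- Second coordinate of the corner arc. [folklore] -/
@[simp] theorem arc_apply_one (a b u : ℝ) : cornerArc a b u 1 = b * cornerRamp (1 / 2 - u) := rfl

/-- The corner arc is smooth. [folklore] -/
theorem contDiff_arc (a b : ℝ) {n : ℕ∞} : ContDiff ℝ n (cornerArc a b) := by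
  rw [contDiff_euclidean]
  intro i
  fin_cases i
  · exact contDiff_const.mul (contDiff_ramp.comp (contDiff_id.add contDiff_const))
  · exact contDiff_const.mul (contDiff_ramp.comp (contDiff_const.sub contDiff_id))

/-- **Above the box the corner arc is the vertical ray**: for `u ≤ -1/2`,
`cornerArc a b u = (0, b (1/2 - u))`. [folklore] -/
theorem arc_of_le {u : ℝ} (hu : u ≤ -1 / 2) : cornerArc a b u = pt2 0 (b * (1 / 2 - u)) := by
  have h1 : cornerRamp (u + 1 / 2) = 0 := ramp_of_nonpos (by linarith)
  have h2 : cornerRamp (1 / 2 - u) = 1 / 2 - u := ramp_of_one_le (by linarith)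
  rw [cornerArc, h1, h2, mul_zero]

/-- **Left of the box the corner arc is the horizontal ray**: for `1/2 ≤ u`,
`cornerArc a b u = (-a (u + 1/2), 0)`. [folklore] -/
theorem arc_of_ge {u : ℝ} (hu : 1 / 2 ≤ u) : cornerArc a b u = pt2 (-a * (u + 1 / 2)) 0 := by
  have h1 : cornerRamp (u + 1 / 2) = u + 1 / 2 := ramp_of_one_le (by linarith)
  have h2 : cornerRamp (1 / 2 - u) = 0 := ramp_of_nonpos (by linarith)
  rw [cornerArc, h1, h2, mul_zero]

/-- **Inside the box**: for `|u| < 1/2` the first coordinate lies in `(-a, 0)` (`a > 0`).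
[folklore] -/
theorem arc_zero_mem_Ioo (ha : 0 < a) {u : ℝ} (hu : |u| < 1 / 2) :
    cornerArc a b u 0 ∈ Ioo (-a) 0 := by
  rw [abs_lt] at hu
  have hp : 0 < cornerRamp (u + 1 / 2) := ramp_pos (by linarith)
  have hl : cornerRamp (u + 1 / 2) < 1 := ramp_lt_one (by linarith)
  rw [arc_apply_zero]
  constructor <;> nlinarith

/-- **Inside the box**: for `|u| < 1/2` the second coordinate lies in `(0, b)` (`b > 0`).
[folklore] -/
theorem arc_one_mem_Ioo (hb : 0 < b) {u : ℝ} (hu : |u| < 1 / 2) :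
    cornerArc a b u 1 ∈ Ioo 0 b := by
  rw [abs_lt] at hu
  have hp : 0 < cornerRamp (1 / 2 - u) := ramp_pos (by linarith)
  have hl : cornerRamp (1 / 2 - u) < 1 := ramp_lt_one (by linarith)
  rw [arc_apply_one]
  constructor <;> nlinarith

/-- The corner arc lies in the closed half-plane `{x ≤ 0}` (`a ≥ 0`). [folklore] -/
theorem arc_zero_nonpos (ha : 0 ≤ a) (u : ℝ) : cornerArc a b u 0 ≤ 0 := by
  rw [arc_apply_zero]
  have := ramp_nonneg (u + 1 / 2)
  nlinarith

/-- The corner arc lies in the closed half-plane `{0 ≤ y}` (`b ≥ 0`). [folklore] -/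
theorem arc_one_nonneg (hb : 0 ≤ b) (u : ℝ) : 0 ≤ cornerArc a b u 1 := by
  rw [arc_apply_one]
  exact mul_nonneg hb (ramp_nonneg _)

/-- The corner arc meets the vertical line `{x = 0}` only for `u ≤ -1/2` (`a > 0`). [folklore] -/
theorem arc_zero_eq_zero_iff (ha : 0 < a) {u : ℝ} : cornerArc a b u 0 = 0 ↔ u ≤ -1 / 2 := by
  rw [arc_apply_zero]
  constructor
  · intro h
    by_contra hlt
    push Not at hlt
    have hp : 0 < cornerRamp (u + 1 / 2) := ramp_pos (by linarith)
    nlinarith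
  · intro h
    rw [ramp_of_nonpos (by linarith), mul_zero]

/-- The corner arc meets the horizontal line `{y = 0}` only for `1/2 ≤ u` (`b > 0`). [folklore] -/
theorem arc_one_eq_zero_iff (hb : 0 < b) {u : ℝ} : cornerArc a b u 1 = 0 ↔ 1 / 2 ≤ u := by
  rw [arc_apply_one]
  constructor
  · intro h
    by_contra hlt
    push Not at hlt
    have hp : 0 < cornerRamp (1 / 2 - u) := ramp_pos (by linarith)
    nlinarith
  · intro h
    rw [ramp_of_nonpos (by linarith), mul_zero]

/-- **The corner arc is injective** (`a, b > 0`): the first coordinate is non-increasing and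
strictly decreasing on `(-1/2, ∞)`, the second non-increasing and strictly decreasing on
`(-∞, 1/2)`, and these two half-lines cover `ℝ`. [folklore] -/
theorem injective_arc (ha : 0 < a) (hb : 0 < b) : Injective (cornerArc a b) := by
  suffices key : ∀ u₁ u₂, u₁ < u₂ → cornerArc a b u₁ ≠ cornerArc a b u₂ by
    intro u₁ u₂ h
    rcases lt_trichotomy u₁ u₂ with hlt | heq | hgt
    · exact absurd h (key _ _ hlt)
    · exact heq
    · exact absurd h.symm (key _ _ hgt)
  intro u₁ u₂ hlt heq
  rcases lt_or_ge (-1 / 2 : ℝ) u₂ with h₂ | h₂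
  · -- the first coordinate separates
    have hx : cornerArc a b u₁ 0 = cornerArc a b u₂ 0 := by rw [heq]
    simp only [arc_apply_zero] at hx
    have hmono : cornerRamp (u₁ + 1 / 2) < cornerRamp (u₂ + 1 / 2) := by
      rcases lt_or_ge (-1 / 2 : ℝ) u₁ with h₁ | h₁
      · exact strictMonoOn_ramp (show (0 : ℝ) ≤ u₁ + 1 / 2 by linarith)
          (show (0 : ℝ) ≤ u₂ + 1 / 2 by linarith) (by linarith)
      · rw [ramp_of_nonpos (by linarith : u₁ + 1 / 2 ≤ 0)]
        exact ramp_pos (by linarith)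
    have : cornerRamp (u₁ + 1 / 2) = cornerRamp (u₂ + 1 / 2) := by
      have h := mul_left_cancel₀ (neg_ne_zero.2 ha.ne') hx
      exact h
    exact hmono.ne this
  · -- both parameters are `≤ -1/2 < 1/2`: the second coordinate separates
    have hy : cornerArc a b u₁ 1 = cornerArc a b u₂ 1 := by rw [heq]
    simp only [arc_apply_one] at hy
    have hmono : cornerRamp (1 / 2 - u₂) < cornerRamp (1 / 2 - u₁) :=
      strictMonoOn_ramp (show (0 : ℝ) ≤ 1 / 2 - u₂ by linarith)
        (show (0 : ℝ) ≤ 1 / 2 - u₁ by linarith) (by linarith)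
    exact hmono.ne (mul_left_cancel₀ hb.ne' hy).symm

/-- The derivative of the corner arc, coordinatewise. [folklore] -/
theorem hasDerivAt_arc (a b u : ℝ) :
    HasDerivAt (cornerArc a b)
      (pt2 (-a * deriv cornerRamp (u + 1 / 2)) (-(b * deriv cornerRamp (1 / 2 - u)))) u := by
  have hd : ∀ v, HasDerivAt cornerRamp (deriv cornerRamp v) v := fun v =>
    ((contDiff_ramp (n := 1)).differentiable (by simp) v).hasDerivAt
  have h0 : HasDerivAt (fun u => -a * cornerRamp (u + 1 / 2))
      (-a * deriv cornerRamp (u + 1 / 2)) u := by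
    have := ((hd (u + 1 / 2)).comp u ((hasDerivAt_id u).add_const (1 / 2))).const_mul (-a)
    simpa using this
  have h1 : HasDerivAt (fun u => b * cornerRamp (1 / 2 - u))
      (-(b * deriv cornerRamp (1 / 2 - u))) u := by
    have := ((hd (1 / 2 - u)).comp u
      ((hasDerivAt_const u (1 / 2 : ℝ)).sub (hasDerivAt_id u))).const_mul b
    simpa using this
  exact hasDerivAt_pt2 h0 h1

/-- **The corner arc is regular** (`a, b > 0`): its derivative never vanishes, since at every
`u` one of `u + 1/2`, `1/2 - u` is positive and there the ramp has positive derivative.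
[folklore] -/
theorem deriv_arc_ne_zero (ha : 0 < a) (hb : 0 < b) (u : ℝ) : deriv (cornerArc a b) u ≠ 0 := by
  rw [(hasDerivAt_arc a b u).deriv]
  intro h0
  have hx : -a * deriv cornerRamp (u + 1 / 2) = 0 := by
    simpa using congrArg (fun w : EuclideanSpace ℝ (Fin 2) => w 0) h0
  have hy : -(b * deriv cornerRamp (1 / 2 - u)) = 0 := by
    simpa using congrArg (fun w : EuclideanSpace ℝ (Fin 2) => w 1) h0
  rcases lt_or_ge (-1 / 2 : ℝ) u with hu | hu
  · have hp : 0 < deriv cornerRamp (u + 1 / 2) := deriv_ramp_pos (by linarith)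
    have : -a * deriv cornerRamp (u + 1 / 2) < 0 := by nlinarith
    exact this.ne hx
  · have hp : 0 < deriv cornerRamp (1 / 2 - u) := deriv_ramp_pos (by linarith)
    have : -(b * deriv cornerRamp (1 / 2 - u)) < 0 := by nlinarith
    exact this.ne hy

/-- The speed of the corner arc on the rays: for `u ≤ -1/2` the derivative is `(0, -b)` and for
`1/2 ≤ u` it is `(-a, 0)` (unit speed after the obvious rescaling). [folklore] -/
theorem deriv_arc_of_le {u : ℝ} (hu : u < -1 / 2) : deriv (cornerArc a b) u = pt2 0 (-b) := by
  rw [(hasDerivAt_arc a b u).deriv, deriv_ramp_of_neg (by linarith : u + 1 / 2 < 0)]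
  have h2 : deriv cornerRamp (1 / 2 - u) = 1 := by
    have hev : cornerRamp =ᶠ[nhds (1 / 2 - u)] fun x => x := by
      filter_upwards [Ioi_mem_nhds (show (1 : ℝ) < 1 / 2 - u by linarith)] with x hx
      exact ramp_of_one_le hx.le
    rw [hev.deriv_eq]
    simp
  rw [h2]
  simp

/-- See `deriv_arc_of_le`. [folklore] -/
theorem deriv_arc_of_ge {u : ℝ} (hu : 1 / 2 < u) : deriv (cornerArc a b) u = pt2 (-a) 0 := by
  rw [(hasDerivAt_arc a b u).deriv, deriv_ramp_of_neg (by linarith : 1 / 2 - u < 0)]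
  have h1 : deriv cornerRamp (u + 1 / 2) = 1 := by
    have hev : cornerRamp =ᶠ[nhds (u + 1 / 2)] fun x => x := by
      filter_upwards [Ioi_mem_nhds (show (1 : ℝ) < u + 1 / 2 by linarith)] with x hx
      exact ramp_of_one_le hx.le
    rw [hev.deriv_eq]
    simp
  rw [h1]
  simp

end CornerRounding

end Literature.Topology.FourManifolds

end
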